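import Summits.BirchSwinnertonDyer.Rank1Residual.GaloisImage.PropagatedConditionCardEP
import Literature.NumberTheory.EllipticCurves.LocalEulerCharacteristicTorsion
import Literature.NumberTheory.EllipticCurves.IwasawaLocalKummerSkeletonProofs
import HarnessLib

/-!
# `#H¹(K_v, C[p]) = #(𝓞_v/p) · #C[p]^{Γ_v}` for a Galois-stable line of prime order whose character
# differs from the cyclotomic character — Tate's Euler–Poincaré characteristic + local duality
# (row T-T3B, file F3; team n1011, seat p12 GEN 8)

HONEST FRAMING (cell `b2b-bsdres`, run/shared/lean/b2b/bsd-rank1-residual/, verbatim in every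
file): the goal of the cell is to DELETE the COMBINATION-SHAPED residual classes of the
Birch–Swinnerton-Dyer formula for ALL analytic-rank `≤ 1` elliptic curves over `ℚ` — "full BSD
formula for every rank `≤ 1` curve in class `C`" assembled STRICTLY from published theorems — so
that the rank-`≤ 1` remainder becomes exactly the CONSTRUCTION-SHAPED classes, which are TYPED
(missing-input `Prop`s), NOT attempted. This is not "finishing BSD". Team n1011 (N10/N11; row
T-T3B = the `v = p` local tower kernel at level `0` for additive potentially good ordinary
reduction, skeleton `cells/n1011/skel/T-T3B.md`): research routes on CONSTRUCTION-SHAPED classes;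
prove what is provable now; no claim beyond stated classes; census output = EVIDENCE, never a
Literature fact; RESIDUAL-MAP marks UNCHANGED; nothing is booked by this file. TOOL THEOREMS ONLY:
no definition, no named fact, nothing cited enters as a hypothesis.

## What

Let `K` be a number field, `v` a finite place, `K_v = v.adicCompletion K`, `Γ_v = Gal(K̄_v/K_v)`,
`A` a discrete `Γ_v`-module with continuous orbit maps ("`E(K̄_v)`") and `C ≤ A` a `Γ_v`-stable
subgroup of PRIME order `p` ("`C[p]`, the `p`-torsion of the canonical line of a good model").
Suppose some `σ ∈ Γ_v` acts on `C` by a scalar `a` and on the `p`-th roots of unity of `K̄_v` by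
`ζ ↦ ζ^b` with `a ≢ b (mod p)` ("the character of `C[p]` is not the cyclotomic character `ω`"; for
the twisted ordinary line of an additive potentially good ordinary curve, inertia acts on `C[p]` by
`ω · ϑ⁻¹` with `ϑ` the RAMIFIED quotient character, so any inertial `σ` moving `E[p]/C[p]` works —
Weil pairing, `det ρ̄_{E,p} = ω`). Then (`PrimeOrderLine.exists_finset_cocycle_reps`):

  the `C`-valued continuous cocycles `Γ_v → A` fall into at most `#(𝓞_v/p) · #C^{Γ_v}` classes
  modulo coboundaries `∂t`, `t ∈ C`

— i.e. `#H¹(K_v, C) = #(𝓞_v/p𝓞_v) · #H⁰(K_v, C)`: Tate's local Euler–Poincaré characteristic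
(Milne *ADT* I Thm. 2.8; the tree's THEOREM `EPCTate.localEulerPoincareCharacteristic`, p04 T-EPC,
through `EP.localEulerPoincareCharacteristic_adicCompletion` /
`localEulerPoincareCharacteristic_adicCompletion`) `#H⁰ · #H² · #(𝓞_v/#C) = #H¹` with
`#H²(K_v, C) = #Hom_{Γ_v}(C, μ_p)` (local duality in bidegree `(2,0)`, Milne I Cor. 2.3; the
tree's THEOREM `natCard_two_eq_natCard_invariants_homRep`) `= 1` (an equivariant `f : C → μ_p` has
`f(σc) = a•f(c) = b•f(c)`, so `f = 0`). For `K = ℚ`, `v = (p)`: `#(ℤ_v/p) = p` (the row's file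
F5). This is the count (S4) of row T-T3B feeding `KummerCount.forall_exists_eq_coboundary_of_card_le`
(file F2, `Iwasawa/KummerCountVanishing`), in the currency of the tree's Lemma-3.4 skeleton
(`Finset` of cocycle representatives, as hypothesis (C1) of
`ResKernel.finite_primary_subgroupResKer_of_reduction`). NO named fact: T-EPC and local duality
are theorems of the tree.

References: [MilneADT2006] J. S. Milne, *Arithmetic Duality Theorems* (2006), I Thm. 2.8, Cor. 2.3;
[SerreGaloisCohomology1997] J.-P. Serre, *Galois Cohomology*, II §5.2 Thm. 2, §5.7 Thm. 5;
[GreenbergLNM1716] R. Greenberg, LNM 1716 (1999), §2 p. 70 (`φψ = χ`), §3 Lemma 3.4 (p. 89).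
-/

noncomputable section

open scoped Classical

open CategoryTheory Function Field NumberField IsDedekindDomain
  Literature.NumberTheory.EllipticCurves Literature.NumberTheory.GaloisRepresentations
  Literature.NumberTheory.EllipticCurves.ResKernel
  Literature.NumberTheory.GaloisRepresentations.DiscreteGaloisModule
  Summit.BirchSwinnertonDyer.Rank1Residual.GaloisImage
open scoped ContRepresentation

universe u

namespace Summit.BirchSwinnertonDyer.Rank1Residual.Iwasawa

namespace PrimeOrderLine

/-! ## §1 `μ_p`: a Galois element raising `p`-th roots of unity to the `b`-th power acts on `μ_p` by `b` -/

section Mu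

variable (F : Type u) [Field F]

/-- If `σ ∈ Γ_F` raises every `n`-th root of unity of `F̄` to the `b`-th power, then on the discrete
Galois module `μ_n` (`mu F n`, written additively) `σ` acts as the scalar `b`. [folklore] -/
theorem mu_apply_eq_nsmul_of_forall_smul_eq_pow {n b : ℕ} (σ : absoluteGaloisGroup F)
    (hσ : ∀ ξ : AlgebraicClosure F, ξ ^ n = 1 → σ • ξ = ξ ^ b) (ζ : MuCarrier F n) :
    mu F n σ ζ = b • ζ := by
  apply MuCarrier.toAdditive.injective
  rw [mu_apply_apply, map_nsmul]
  change Additive.ofMul (σ • (MuCarrier.toAdditive ζ).toMul) =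
    Additive.ofMul ((MuCarrier.toAdditive ζ).toMul ^ b)
  refine congrArg Additive.ofMul (Subtype.ext (Units.ext ?_))
  rw [absoluteGaloisGroup.coe_smul_rootsOfUnity, Units.coe_smul, SubmonoidClass.coe_pow,
    Units.val_pow_eq_pow_val]
  refine hσ _ ?_
  have h := (mem_rootsOfUnity n ((MuCarrier.toAdditive ζ).toMul : (AlgebraicClosure F)ˣ)).mp
    ((MuCarrier.toAdditive ζ).toMul).2
  rw [← Units.val_pow_eq_pow_val, h, Units.val_one]

/-- Every element of `μ_n` (additively written) is killed by `n`. [folklore] -/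
theorem nsmul_muCarrier_eq_zero (n : ℕ) (ζ : MuCarrier F n) : n • ζ = 0 := by
  apply MuCarrier.toAdditive.injective
  rw [map_nsmul, map_zero]
  change Additive.ofMul ((MuCarrier.toAdditive ζ).toMul ^ n) = Additive.ofMul 1
  refine congrArg Additive.ofMul (Subtype.ext ?_)
  rw [SubmonoidClass.coe_pow, OneMemClass.coe_one]
  exact (mem_rootsOfUnity n ((MuCarrier.toAdditive ζ).toMul : (AlgebraicClosure F)ˣ)).mp
    ((MuCarrier.toAdditive ζ).toMul).2

end Mu

/-! ## §2 The count -/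

section Count

variable (K : Type) [Field K] [NumberField K] (v : HeightOneSpectrum (𝓞 K))
variable {A : Type} [AddCommGroup A]
  [DistribMulAction (absoluteGaloisGroup (v.adicCompletion K)) A] [TopologicalSpace A]
  [DiscreteTopology A]

omit [TopologicalSpace A] [DiscreteTopology A] in
/-- Bezout bookkeeping: for `x` killed by the prime `p` (`p ^ 1 • x = 0`, the shape produced by the
duality lemma at `k = 1`), `a • x = b • x` with `a ≢ b (mod p)` forces `x = 0`. [folklore] -/
theorem eq_zero_of_nsmul_eq_nsmul {M : Type*} [AddCommGroup M] {p : ℕ} [hp : Fact p.Prime]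
    {a b : ℕ} (hab : ¬ a ≡ b [MOD p]) {x : M} (hpx : p ^ 1 • x = 0) (h : a • x = b • x) :
    x = 0 := by
  rw [pow_one] at hpx
  have hd : ((a : ℤ) - b) • x = 0 := by rw [sub_smul, natCast_zsmul, natCast_zsmul, h, sub_self]
  have hcop : IsCoprime ((a : ℤ) - b) (p : ℤ) := by
    rw [Int.isCoprime_iff_gcd_eq_one]
    have hdvd' : Int.gcd ((a : ℤ) - b) p ∣ p := by exact_mod_cast Int.gcd_dvd_right ((a : ℤ) - b) p
    rcases (Nat.dvd_prime hp.out).mp hdvd' with h1 | h2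
    · exact h1
    · exfalso
      have hpd : (p : ℤ) ∣ (a : ℤ) - b := by rw [← h2]; exact Int.gcd_dvd_left _ _
      exact hab (Nat.modEq_iff_dvd.mpr ((dvd_sub_comm.mp hpd)))
  obtain ⟨α, β, hαβ⟩ := hcop
  calc x = (α * ((a : ℤ) - b) + β * (p : ℤ)) • x := by rw [hαβ, one_smul]
    _ = 0 := by rw [add_smul, mul_smul, mul_smul, hd, smul_zero, zero_add, natCast_zsmul, hpx,
        smul_zero]

/-- **`#H¹(K_v, C) ≤ #(𝓞_v/p) · #C^{Γ_v}` as a finite set of cocycle representatives.** Let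
`C ≤ A` be a `Γ_v`-stable subgroup of prime order `p` of a discrete `Γ_v`-module `A` with continuous
orbit maps, and suppose some `σ ∈ Γ_v` acts on `C` as the scalar `a` and on the `p`-th roots of
unity of `K̄_v` as `ζ ↦ ζ^b` with `a ≢ b (mod p)`. Then there is a finite set `S` of continuous
cocycles `Γ_v → A` with `#S ≤ #(𝓞_v/p𝓞_v) · #{c ∈ C : Γ_v c = c}` such that every `C`-valued
continuous cocycle `ψ` satisfies `ψ − ψ₀ = ∂t` for some `ψ₀ ∈ S`, `t ∈ C`. Proof: on the finite
discrete module `C` (as a `ContinuousRep`, whose `TopRep` is the tree's `discreteTopRep`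
definitionally), Tate's local Euler–Poincaré characteristic
(`localEulerPoincareCharacteristic_adicCompletion` fed with the THEOREM
`EP.localEulerPoincareCharacteristic_adicCompletion`) reads `#C^{Γ_v} · #H²(K_v, C) · #(𝓞_v/p) = #H¹(K_v, C)`,
and `#H²(K_v, C) = #Hom_{Γ_v}(C, μ_p)` (`natCard_two_eq_natCard_invariants_homRep`) `= 1`
(`f(σc) = a•f(c)` versus `σ•f(c) = b•f(c)`, `eq_zero_of_nsmul_eq_nsmul`); representatives of the
finitely many classes of `H¹(Γ_v, C)`, pushed into `A`, form `S`.
[cite: MilneADT2006, Ch. I §2, Thm. 2.8 (p. 31) and Cor. 2.3]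
[cite: GreenbergLNM1716, §3 Lemma 3.4 (p. 89)] -/
theorem exists_finset_cocycle_reps
    (hcont : ∀ a : A, Continuous fun g : absoluteGaloisGroup (v.adicCompletion K) ↦ g • a)
    (p : ℕ) [hp : Fact p.Prime] (C : AddSubgroup A)
    (hC : ∀ (g : absoluteGaloisGroup (v.adicCompletion K)) (a : A), a ∈ C → g • a ∈ C)
    (hpC : ∀ a ∈ C, p • a = 0) (hcard : Nat.card C = p)
    (hχ : ∃ (σ : absoluteGaloisGroup (v.adicCompletion K)) (a b : ℕ), (∀ c ∈ C, σ • c = a • c) ∧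
      (∀ ζ : AlgebraicClosure (v.adicCompletion K), ζ ^ p = 1 → σ • ζ = ζ ^ b) ∧ ¬ a ≡ b [MOD p]) :
    ∃ S : Finset (contOneCocycles (discreteTopRep (absoluteGaloisGroup (v.adicCompletion K)) A)),
      S.card ≤ Nat.card (v.adicCompletionIntegers K ⧸
          Ideal.span {((p : ℕ) : v.adicCompletionIntegers K)}) *
        Nat.card {a : A // a ∈ C ∧ ∀ g : absoluteGaloisGroup (v.adicCompletion K), g • a = a} ∧
      ∀ ψ : contOneCocycles (discreteTopRep (absoluteGaloisGroup (v.adicCompletion K)) A),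
        (∀ g, ψ.1 g ∈ C) → ∃ ψ₀ ∈ S, ∃ t ∈ C, ∀ g, ψ.1 g - ψ₀.1 g = g • t - t := by
  -- notation
  let Γ := absoluteGaloisGroup (v.adicCompletion K)
  haveI : CharZero (v.adicCompletion K) :=
    charZero_of_injective_algebraMap (algebraMap K (v.adicCompletion K)).injective
  -- `H²` needs `LocallyCompactSpace Γ_v`: compactness of the absolute Galois group, locally
  haveI := absoluteGaloisGroup_compactSpace (v.adicCompletion K)
  -- the `Γ`-module structure on `↥C`
  letI iSMul : SMul Γ C := ⟨fun g c ↦ ⟨g • (c : A), hC g c c.2⟩⟩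
  have hsmulC : ∀ (g : Γ) (c : C), ((g • c : C) : A) = g • (c : A) := fun _ _ ↦ rfl
  letI iDMA : DistribMulAction Γ C :=
    { one_smul := fun c ↦ Subtype.ext (by rw [hsmulC, one_smul])
      mul_smul := fun g h c ↦ Subtype.ext (by rw [hsmulC, hsmulC, hsmulC, mul_smul])
      smul_zero := fun g ↦ Subtype.ext (by rw [hsmulC, ZeroMemClass.coe_zero, smul_zero])
      smul_add := fun g c d ↦ Subtype.ext (by
        rw [hsmulC, AddMemClass.coe_add, smul_add, AddMemClass.coe_add, hsmulC, hsmulC]) }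
  have hcontC : ∀ c : C, Continuous fun g : Γ ↦ g • c := fun c ↦
    (hcont (c : A)).subtype_mk _
  haveI : Finite C := Nat.finite_of_card_ne_zero (by rw [hcard]; exact hp.out.ne_zero)
  -- `C` as a `ContinuousRep` of `Γ` over `ℤ`; its `TopRep` is the tree's `discreteTopRep`
  let ρ : ContinuousRep Γ ℤ C :=
    { toRepresentation := (discreteContRep Γ C).toRepresentation
      continuous_smul := by
        refine continuous_prod_of_discrete_right.mpr fun c ↦ ?_
        exact hcontC c }
  have hρ : ∀ (g : Γ) (c : C), ρ g c = g • c := fun _ _ ↦ rfl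
  have hbridge : ρ.toTopRep = discreteTopRep Γ C := rfl
  -- Tate's local Euler–Poincaré characteristic for `C`
  obtain ⟨hfin1, -, hEPC⟩ := localEulerPoincareCharacteristic_adicCompletion K v
    (EP.localEulerPoincareCharacteristic_adicCompletion K v) ρ
  -- `#H²(K_v, C) = #Hom_Γ(C, μ_p) = 1`
  have hM : ∀ c : C, p ^ 1 • c = 0 := fun c ↦ Subtype.ext (by
    rw [pow_one, AddSubmonoidClass.coe_nsmul, ZeroMemClass.coe_zero]; exact hpC c c.2)
  obtain ⟨-, h2⟩ := natCard_two_eq_natCard_invariants_homRep (v.adicCompletion K) ρ hM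
  have hinv1 : Nat.card (ρ.homRep (mu (v.adicCompletion K) (p ^ 1))).toTopRep.ρ.invariants = 1 := by
    obtain ⟨σ, a, b, hσC, hσμ, hab⟩ := hχ
    haveI : Subsingleton (ρ.homRep (mu (v.adicCompletion K) (p ^ 1))).toTopRep.ρ.invariants := by
      refine ⟨fun f₁ f₂ ↦ ?_⟩
      suffices key : ∀ f : (ρ.homRep (mu (v.adicCompletion K) (p ^ 1))).toTopRep.ρ.invariants,
          ∀ c : C, (f.1 : HomCarrier C (MuCarrier (v.adicCompletion K) (p ^ 1))) c = 0 by
        exact Subtype.ext (HomCarrier.ext fun c ↦ by rw [key f₁ c, key f₂ c])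
      intro f c
      have hf := f.2 σ
      change (ρ.homRep (mu (v.adicCompletion K) (p ^ 1))) σ f.1 = f.1 at hf
      rw [ContinuousRep.homRep_apply_eq_self_iff] at hf
      have h1 := hf c
      rw [mu_apply_eq_nsmul_of_forall_smul_eq_pow (v.adicCompletion K) σ
        (fun ζ hζ ↦ hσμ ζ (by rwa [pow_one] at hζ)), hρ] at h1
      have hσc : σ • c = a • c := Subtype.ext (by
        rw [hsmulC, AddSubmonoidClass.coe_nsmul]; exact hσC c c.2)
      rw [hσc, map_nsmul] at h1
      exact eq_zero_of_nsmul_eq_nsmul (p := p) hab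
        (nsmul_muCarrier_eq_zero (v.adicCompletion K) (p ^ 1) _) h1.symm
    exact Nat.card_of_subsingleton (0 : (ρ.homRep (mu (v.adicCompletion K) (p ^ 1))).toTopRep.ρ.invariants)
  have h2' : Nat.card (galoisCohomology ρ 2) = 1 := by rw [← hinv1]; exact h2
  -- `#C^{Γ}` as a subtype of `A`
  have hinv : Nat.card ρ.toTopRep.ρ.invariants =
      Nat.card {a : A // a ∈ C ∧ ∀ g : Γ, g • a = a} := by
    refine Nat.card_congr
      { toFun := fun m ↦ ⟨((m.1 : C) : A), (m.1 : C).2, fun g ↦ ?_⟩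
        invFun := fun a ↦ ⟨⟨a.1, a.2.1⟩, ?_⟩
        left_inv := fun m ↦ rfl
        right_inv := fun a ↦ rfl }
    · have h := (Representation.mem_invariants _ _).mp m.2 g
      change ρ g m.1 = m.1 at h
      rw [hρ] at h
      rw [← hsmulC, h]
    · refine (Representation.mem_invariants _ _).mpr fun g ↦ ?_
      change ρ g _ = _
      rw [hρ]
      exact Subtype.ext (a.2.2 g)
  -- the count `#H¹(Γ, C) = #(𝓞_v/p) · #C^Γ`
  have hcardM : Nat.card C = p := hcard
  rw [h2', mul_one, hcardM, hinv] at hEPC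
  -- representatives
  change Finite (continuousCohomology 1 ρ.toTopRep) at hfin1
  rw [hbridge] at hfin1
  haveI : Finite (discreteH1 Γ C) := hfin1
  letI : Fintype (discreteH1 Γ C) := Fintype.ofFinite _
  choose φ hφ using fun c : discreteH1 Γ C ↦ oneCocycleClass_surjective _ c
  -- push-forward along the inclusion `ι : C → A`
  have hι : ∀ (g : Γ) (c : C), C.subtype (g • c) = g • C.subtype c := fun g c ↦ hsmulC g c
  let push : contOneCocycles (discreteTopRep Γ C) → contOneCocycles (discreteTopRep Γ A) :=
    fun φ' ↦ contOneCocycles.pullback (ContinuousMonoidHom.id Γ)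
      (resHomOfEquivariant (ContinuousMonoidHom.id Γ) C.subtype (compat_id_of_equivariant C.subtype hι)) φ'
  have hpush : ∀ (φ' : contOneCocycles (discreteTopRep Γ C)) (g : Γ),
      (push φ').1 g = ((φ'.1 g : C) : A) := fun φ' g ↦ ResKernel.pullback_id_apply C.subtype hι φ' g
  refine ⟨Finset.univ.image fun c ↦ push (φ c), ?_, fun ψ hψ ↦ ?_⟩
  · -- the bound
    refine Finset.card_image_le.trans ?_
    rw [Finset.card_univ, Fintype.card_eq_nat_card]
    change Nat.card (continuousCohomology 1 (discreteTopRep Γ C)) ≤ _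
    rw [← hbridge]
    change Nat.card (galoisCohomology ρ 1) ≤ _
    rw [← hEPC, mul_comm]
  · -- every `C`-valued cocycle is equivalent to a representative
    let ψC : contOneCocycles (discreteTopRep Γ C) :=
      ⟨⟨fun g ↦ ⟨ψ.1 g, hψ g⟩, ψ.1.continuous.subtype_mk _⟩, fun g h ↦ Subtype.ext (by
        change ψ.1 (g * h) = ψ.1 g + g • ψ.1 h
        exact ψ.2 g h)⟩
    have hψC : ∀ g, ((ψC.1 g : C) : A) = ψ.1 g := fun _ ↦ rfl
    set c := oneCocycleClass _ ψC with hc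
    have hdiff : oneCocycleClass _ (ψC - φ c) = 0 := by
      rw [oneCocycleClass_sub, hφ c, ← hc, sub_self]
    obtain ⟨t, ht⟩ := (oneCocycleClass_eq_zero_iff _ _).mp hdiff
    refine ⟨push (φ c), Finset.mem_image.mpr ⟨c, Finset.mem_univ _, rfl⟩, (t : A), t.2, fun g ↦ ?_⟩
    have h := congrArg (fun x : C ↦ (x : A)) (ht g)
    simp only [ContinuousMap.sub_apply, AddSubgroupClass.coe_sub] at h
    rw [hpush, ← hψC g]
    rw [h]
    change ((g • t : C) : A) - (t : A) = g • (t : A) - (t : A)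
    rw [hsmulC]

end Count

end PrimeOrderLine

end Summit.BirchSwinnertonDyer.Rank1Residual.Iwasawa

end
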